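import Mathlib.Analysis.SpecialFunctions.Pow.Real

/-!
# (M2′) window arithmetic for the Stokes-row assembly at `θb := d·L·α₁∕8`

Support file (ym3-torus-px20 g4, LEAD-H ★w5-19200 g7 WORD 20 (4)) for crux `MinimiserStabilityRegPr`, line H, registered stub
`BirthV10.stub_halvingStep`: the two numeric windows `hhalf`, `hwin` of w8 g9's assembly
✓`HalvingH42TopCrossAssemblyR33.h42topCrossT_of_stokes`, discharged from the floor `1782·(ρ′+M′+1)ε₀ ≤ d·L·α₁`,
the smallness `d·L·α₁ ≤ 1∕8`, and the exported second-order row `Cb ≤ 2(ρ′+M′+1)ε₀` (✓`HalvingHSupURhoWindowsRho3Cb`). Pure real arithmetic.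

References: T. Balaban, *Comm. Math. Phys.* **98** (1985), Prop. 3, (1.42) p. 83 [cite: Balaban1985RegularSpaces];
T. Balaban, *Comm. Math. Phys.* **99** (1985) [cite: Balaban1985BackgroundPropagators]. The arithmetic is ours.
-/

namespace Summit.QuantumFields.YangMills.Theorems.HalvingHStokesWindowOfCb

/-- ★ (M2′) WINDOW ARITHMETIC for ✓`h42topCrossT_of_stokes` at `θb := T∕8`, `T := d·L·α₁`: with `1782·x ≤ T ≤ 1∕8` (so `x ≤ 10⁻⁴`), `a ≤ 198x`,
`0 < T`, `0 ≤ Cb ≤ 2x`, both `a + 2(10Cb + 2(T∕8)(1+10Cb))(1+a) ≤ ½` and `2·(a + 2(10Cb + 2(T∕8)(1+10Cb))(1+a)) < 2·T`.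
[cite: Balaban1985RegularSpaces, Prop. 3 (1.42) p.83] (elementary; our arithmetic) -/
theorem window_of_cb {x T a Cb : ℝ} (hTpos : 0 < T) (hT : 1782 * x ≤ T) (hT8 : T ≤ 1 / 8)
    (ha : a ≤ 198 * x) (hCb0 : 0 ≤ Cb) (hCb : Cb ≤ 2 * x) :
    a + 2 * (10 * Cb + 2 * (T / 8) * (1 + 10 * Cb)) * (1 + a) ≤ 1 / 2 ∧
    2 * (a + 2 * (10 * Cb + 2 * (T / 8) * (1 + 10 * Cb)) * (1 + a)) < 2 * T := by
  have hT0 : 0 ≤ T := hTpos.le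
  have h1 : 1 + a ≤ 51 / 50 := by linarith [ha, hT, hT8]
  have h2 : 1 + 10 * Cb ≤ 1002 / 1000 := by linarith [hCb, hT, hT8]
  have hin : 10 * Cb + 2 * (T / 8) * (1 + 10 * Cb) ≤ 20 * x + (T / 4) * (1002 / 1000) := by
    have e : 2 * (T / 8) * (1 + 10 * Cb) ≤ 2 * (T / 8) * (1002 / 1000) := mul_le_mul_of_nonneg_left h2 (by positivity)
    nlinarith [e, hCb]
  have hprod : 2 * (10 * Cb + 2 * (T / 8) * (1 + 10 * Cb)) * (1 + a) ≤ 2 * (20 * x + (T / 4) * (1002 / 1000)) * (51 / 50) := by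
    have e1 : 2 * (10 * Cb + 2 * (T / 8) * (1 + 10 * Cb)) * (1 + a) ≤ 2 * (10 * Cb + 2 * (T / 8) * (1 + 10 * Cb)) * (51 / 50) :=
      mul_le_mul_of_nonneg_left h1 (by positivity)
    have e2 : 2 * (10 * Cb + 2 * (T / 8) * (1 + 10 * Cb)) * ((51 : ℝ) / 50) ≤ 2 * (20 * x + (T / 4) * (1002 / 1000)) * (51 / 50) :=
      mul_le_mul_of_nonneg_right (mul_le_mul_of_nonneg_left hin (by norm_num)) (by norm_num)
    exact e1.trans e2
  constructor
  · linarith [hprod, ha, hT, hT8, hT0]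
  · linarith [hprod, ha, hT, hTpos]

end Summit.QuantumFields.YangMills.Theorems.HalvingHStokesWindowOfCb
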